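import Summits.BirchSwinnertonDyer.BirchSwinnertonDyer.Theorems.ClassRecordThreeEulerHalvesAtThreeCartanSupplyFixedPointsP1
import HarnessLib

/-!
# Kernel and column counts for `2 × 2` matrices over `𝔽_q` (eigenvector counting for the cubic points)

Helper file `--supports stmt-BirchSwinnertonDyer-23422` (seat `bsd-stepL-tam3-p1` g23, LINE OWNER of crux 23422 `EulerHalvesAtThreeResidualUpperBound`,
line `cartan` v11), serving the registered stub (SUPPLY) `stub_cartanTorusLatticeSupply : CartanCorrespondence.CartanTorusLatticeSupply` via
`HOME/tam3-p1/g23/SUPPLY-ROAD-GG1.md` §1–§2: by `…CartanSupplyCubicPoints` (`inv_mul_mul_mem_cubicBorel_iff`), the fixed points of `g` on the cubic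
points `GL₂(𝔽_q) ⧸ H` are counted by pairs (eigenvector `v` of `g`, second column `w` with `(v w)` invertible). THIS FILE supplies the two
elementary counts: `#{v : M v = 0} = q² ∣ q ∣ 1` for a `2 × 2` matrix `M` that is zero ∣ non-zero singular ∣ invertible
(`card_ker_of_eq_zero`, `card_ker_of_det_eq_zero`, `card_ker_of_det_ne_zero`), and `#{w : det(v w) = 0} = q` for `v ≠ 0` (`card_collinear`),
hence `#{w : det(v w) ≠ 0} = q² − q` (`card_not_collinear`).
HONEST FRAMING: finite-field counting; nothing about SUPPLY, NUM, crux 23422 ∕ 19109 is proved here; BSD is proved for no curve. [folklore]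
-/

namespace Summit.BirchSwinnertonDyer.BirchSwinnertonDyer.Theorems.CartanSupply.KernelCounts

open Summit.BirchSwinnertonDyer.BirchSwinnertonDyer.Theorems.CartanTorusCubeCut

set_option linter.dupNamespace false
set_option autoImplicit false

open scoped Classical

variable {q : ℕ} [Fact q.Prime]

/-! ## §1 Lines in `𝔽_q²` -/

/-- PROVED: for `v ≠ 0`, the vectors `w` with `v₀ w₁ = v₁ w₀` (collinear with `v`) number `q`. [folklore] -/
theorem card_collinear (v : Fin 2 → ZMod q) (hv : v ≠ 0) :
    (Finset.univ.filter fun w : Fin 2 → ZMod q => v 0 * w 1 = v 1 * w 0).card = q := by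
  -- the collinear vectors are exactly the multiples `t • v`, `t ∈ 𝔽_q`, and `t ↦ t • v` is injective
  have hinj : Function.Injective fun t : ZMod q => t • v := by
    intro s t hst
    by_contra hne
    apply hv
    have h := sub_eq_zero.mpr hst
    rw [← sub_smul] at h
    exact (smul_eq_zero.mp h).resolve_left (sub_ne_zero.mpr hne)
  have hset : (Finset.univ.filter fun w : Fin 2 → ZMod q => v 0 * w 1 = v 1 * w 0) =
      Finset.univ.image fun t : ZMod q => t • v := by
    ext w
    simp only [Finset.mem_filter, Finset.mem_univ, true_and, Finset.mem_image]
    constructor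
    · intro h
      -- pick the coordinate where `v` is non-zero
      by_cases h0 : v 0 ≠ 0
      · refine ⟨w 0 / v 0, ?_⟩
        funext i
        fin_cases i
        · simp [h0]
        · show w 0 / v 0 * v 1 = w 1
          field_simp
          linear_combination -h
      · have h0' : v 0 = 0 := not_not.mp h0
        have h1 : v 1 ≠ 0 := by
          intro h1; apply hv; funext i; fin_cases i <;> simp [h0', h1]
        refine ⟨w 1 / v 1, ?_⟩
        funext i
        fin_cases i
        · show w 1 / v 1 * v 0 = w 0
          rw [h0', mul_zero]
          have := h
          rw [h0', zero_mul] at this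
          -- `0 = v 1 * w 0` with `v 1 ≠ 0`
          exact ((mul_eq_zero.mp this.symm).resolve_left h1).symm
        · simp [h1]
    · rintro ⟨t, rfl⟩
      simp only [Pi.smul_apply, smul_eq_mul]
      ring
  rw [hset, Finset.card_image_of_injective _ hinj, Finset.card_univ, ZMod.card]

/-- PROVED: for `v ≠ 0`, the vectors `w` NOT collinear with `v` number `q² − q`. [folklore] -/
theorem card_not_collinear (v : Fin 2 → ZMod q) (hv : v ≠ 0) :
    (Finset.univ.filter fun w : Fin 2 → ZMod q => v 0 * w 1 ≠ v 1 * w 0).card = q ^ 2 - q := by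
  have h := Finset.card_filter_add_card_filter_not (s := (Finset.univ : Finset (Fin 2 → ZMod q)))
    (fun w : Fin 2 → ZMod q => v 0 * w 1 = v 1 * w 0)
  rw [card_collinear v hv, Finset.card_univ, Fintype.card_fun, ZMod.card, Fintype.card_fin] at h
  have : (Finset.univ.filter fun w : Fin 2 → ZMod q => ¬ v 0 * w 1 = v 1 * w 0).card = q ^ 2 - q := by omega
  convert this using 2

/-! ## §2 Kernels of `2 × 2` matrices -/

/-- PROVED: the zero matrix kills every vector: `q²` of them. [folklore] -/
theorem card_ker_of_eq_zero (M : Mat q) (hM : M = 0) :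
    (Finset.univ.filter fun v : Fin 2 → ZMod q => M.mulVec v = 0).card = q ^ 2 := by
  rw [Finset.filter_true_of_mem (fun v _ => by rw [hM, Matrix.zero_mulVec]), Finset.card_univ, Fintype.card_fun, ZMod.card,
    Fintype.card_fin]

/-- PROVED: an invertible matrix kills only `0`. [folklore] -/
theorem card_ker_of_det_ne_zero (M : Mat q) (hM : M.det ≠ 0) :
    (Finset.univ.filter fun v : Fin 2 → ZMod q => M.mulVec v = 0).card = 1 := by
  rw [Finset.card_eq_one]
  refine ⟨0, ?_⟩
  ext v
  simp only [Finset.mem_filter, Finset.mem_univ, true_and, Finset.mem_singleton]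
  constructor
  · intro h
    have hu : IsUnit M.det := isUnit_iff_ne_zero.mpr hM
    have := congrArg (M⁻¹.mulVec) h
    rwa [Matrix.mulVec_mulVec, Matrix.nonsing_inv_mul M hu, Matrix.one_mulVec, Matrix.mulVec_zero] at this
  · rintro rfl; exact Matrix.mulVec_zero M

/-- PROVED: the kernel of `M` in coordinates. [folklore] -/
theorem mulVec_eq_zero_iff (M : Mat q) (v : Fin 2 → ZMod q) :
    M.mulVec v = 0 ↔ M 0 0 * v 0 + M 0 1 * v 1 = 0 ∧ M 1 0 * v 0 + M 1 1 * v 1 = 0 := by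
  constructor
  · intro h
    have h0 := congrFun h 0
    have h1 := congrFun h 1
    simp [Matrix.mulVec, dotProduct, Fin.sum_univ_two] at h0 h1
    exact ⟨h0, h1⟩
  · rintro ⟨h0, h1⟩
    funext i
    fin_cases i <;> simp [Matrix.mulVec, dotProduct, Fin.sum_univ_two, h0, h1]

/-- PROVED: a NON-ZERO SINGULAR `2 × 2` matrix has exactly `q` vectors in its kernel: the kernel is the line of vectors collinear with
`(−r₁, r₀)` for a non-zero row `r` (the other row is proportional). [folklore] -/
theorem card_ker_of_det_eq_zero (M : Mat q) (hM : M ≠ 0) (hdet : M.det = 0) :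
    (Finset.univ.filter fun v : Fin 2 → ZMod q => M.mulVec v = 0).card = q := by
  rw [Matrix.det_fin_two] at hdet
  -- a non-zero row
  have hrow : (M 0 0 ≠ 0 ∨ M 0 1 ≠ 0) ∨ (M 1 0 ≠ 0 ∨ M 1 1 ≠ 0) := by
    by_contra h
    push Not at h
    apply hM
    ext i j
    fin_cases i <;> fin_cases j
    · exact h.1.1
    · exact h.1.2
    · exact h.2.1
    · exact h.2.2
  rcases hrow with hr | hr
  · -- row 0 non-zero: kernel = {v : M₀₀ v₀ + M₀₁ v₁ = 0} (row 1 is a consequence), = vectors collinear with n := (M₀₁, −M₀₀)... use `(-M 0 1, M 0 0)`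
    let n : Fin 2 → ZMod q := ![-M 0 1, M 0 0]
    have hn : n ≠ 0 := by
      intro h
      rcases hr with h' | h'
      · exact h' (by have := congrFun h 1; simpa [n] using this)
      · exact h' (by have := congrFun h 0; simpa [n] using this)
    refine Eq.trans ?_ (card_collinear n hn)
    congr 1
    ext v
    simp only [Finset.mem_filter, Finset.mem_univ, true_and, mulVec_eq_zero_iff]
    simp only [n, Matrix.cons_val_zero, Matrix.cons_val_one]
    constructor
    · rintro ⟨h0, -⟩
      linear_combination -h0
    · intro h
      have h0 : M 0 0 * v 0 + M 0 1 * v 1 = 0 := by linear_combination -h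
      refine ⟨h0, ?_⟩
      -- row 1 = (M₁₀, M₁₁) is proportional to row 0 since det = 0
      rcases hr with h00 | h01
      · have : M 1 0 * v 0 + M 1 1 * v 1 = (M 1 0 / M 0 0) * (M 0 0 * v 0 + M 0 1 * v 1) := by
          field_simp
          linear_combination (v 1) * hdet
        rw [this, h0, mul_zero]
      · have : M 1 0 * v 0 + M 1 1 * v 1 = (M 1 1 / M 0 1) * (M 0 0 * v 0 + M 0 1 * v 1) := by
          field_simp
          linear_combination (-v 0) * hdet
        rw [this, h0, mul_zero]
  · let n : Fin 2 → ZMod q := ![-M 1 1, M 1 0]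
    have hn : n ≠ 0 := by
      intro h
      rcases hr with h' | h'
      · exact h' (by have := congrFun h 1; simpa [n] using this)
      · exact h' (by have := congrFun h 0; simpa [n] using this)
    refine Eq.trans ?_ (card_collinear n hn)
    congr 1
    ext v
    simp only [Finset.mem_filter, Finset.mem_univ, true_and, mulVec_eq_zero_iff]
    simp only [n, Matrix.cons_val_zero, Matrix.cons_val_one]
    constructor
    · rintro ⟨-, h1⟩
      linear_combination -h1
    · intro h
      have h1 : M 1 0 * v 0 + M 1 1 * v 1 = 0 := by linear_combination -h
      refine ⟨?_, h1⟩
      rcases hr with h10 | h11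
      · have : M 0 0 * v 0 + M 0 1 * v 1 = (M 0 0 / M 1 0) * (M 1 0 * v 0 + M 1 1 * v 1) := by
          field_simp
          linear_combination (-v 1) * hdet
        rw [this, h1, mul_zero]
      · have : M 0 0 * v 0 + M 0 1 * v 1 = (M 0 1 / M 1 1) * (M 1 0 * v 0 + M 1 1 * v 1) := by
          field_simp
          linear_combination (v 0) * hdet
        rw [this, h1, mul_zero]

end Summit.BirchSwinnertonDyer.BirchSwinnertonDyer.Theorems.CartanSupply.KernelCounts
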